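import Literature.AlgebraicGeometry.HodgeTheory.VHSDataInteriorChart
import Literature.AlgebraicGeometry.HodgeTheory.PolarizedLimitMixedHodgeStructureTateTwist
import Literature.AlgebraicGeometry.HodgeTheory.HodgeStructureWeilJacobianDual
import Literature.AlgebraicGeometry.Motives.FamiliesVHSConstant
import Literature.AlgebraicGeometry.Motives.FamiliesVHSTateTwist
import HarnessLib

/-!
# Local period charts of a polarized `ℤ`-variation under change of weight, Tate twist, and for constant variations: the charts of `D.cast h`,
# `D(j)`, `ℤ_S(j)`, `ℤ_S` (puncture and interior)

Topic `Literature/AlgebraicGeometry/HodgeTheory` (namespaces `Literature.AlgebraicGeometry.Motives[.VHSData.PunctureChart ∕ .InteriorChart]`,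
`….HodgeTheory.PolarizedLimitMixedHodgeStructure`), lane `lit-hodgefound` (seat `p08`, row g58-#4); companion of `VHSDataPunctureChart` (puncture
charts, `⊗`) and `VHSDataInteriorChart` (interior charts, `⊗`).  DEFINITIONS WITH BODIES (`PunctureChart.cast ∕ tateTwist ∕ const ∕ tate ∕ unit`,
`InteriorChart.cast ∕ tateTwist ∕ const ∕ tate ∕ unit`) and THEOREMS; no named fact, no instance (D-0026 net debt `0`).

PRINTED SOURCES.  P. Deligne, *Théorie de Hodge II*, 2.1.13–2.1.15 (the Tate structure `ℚ(j)`, Tate twists `H(j) = H ⊗ ℚ(j)`: same space,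
`F^pH(j) = F^{p+j}H`, weight `k − 2j`; polarizations).  E. Cattani, F. El Zein, P. Griffiths, Lê D. T., *Hodge Theory* (2014): Ex. 3.2.23 (4)
(Tate twist of a mixed Hodge structure), (7.6.2) (`gl(V)^{a,b}`), Def. 7.5.9 (polarized limit MHS; with `N = 0` a polarized pure Hodge structure —
the tree's `Polarization.toPolarizedLimitMixedHodgeStructure`).  E. Cattani, P. Deligne, A. Kaplan, *On the locus of Hodge classes* (1995), §1,
(2.4), 2.7 (the local period charts).  J. Carlson, S. Müller-Stach, C. Peters, *Period Mappings and Period Domains* (2017), §2.3 (2.6) (`C = i^{p−q}`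
on `H^{p,q}`), Thm. 2.3.3 (the Hodge metric), §15.3 (constant variations).

CONTENT.
* §1 Tate twists in linear algebra: **`gl(H(j))^{a,b} = gl(H)^{a,b}`** (`MixedHodgeStructure.endPiece_tateTwist`, from the tree's
  `deligneI_tateTwist`) and **`‖·‖_{Q(j)} = ‖·‖_Q`** (`Polarization.hodgeNorm_tateTwist`, from the tree's `HodgeTheory.weilOperator_tateTwist`,
  `C_{H(j)} = C_H`); `tateTwist_endPiece(_biSup)`, `tateTwist_monodromy` for polarized limit MHS; `toPolarizedLimitMixedHodgeStructure_monodromy`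
  (`T = 1` when `N = 0`).
* §2 **`PunctureChart.cast ∕ InteriorChart.cast`** (transport along `k = k′`) and **`PunctureChart.tateTwist ∕ InteriorChart.tateTwist`**: a chart
  of `D` with limit `L` (reference `(H₀, Q₀)`) is a chart of `D(j)` with limit `L(j)` (reference `(H₀(j), Q₀(j))`) — same gauge, frame, lattice,
  trivialization, height and comparison constant.
* §3 **the charts of a CONSTANT variation** `VHSData.const S hι Q` (`M ⊆ V = M ⊗ ℚ` with a polarized Hodge structure `(H, Q)`): at a puncture along
  any `σ` the limit is `(H, Q)` with `N = 0` (trivial local monodromy, `Polarization.toPolarizedLimitMixedHodgeStructure`), `Γ = 0`, `Λ = ι(M)`, `e = id`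
  (`PunctureChart.const`); on any coordinate disc with preconnected target the interior chart has `h = 1`, `κ = 1` (`InteriorChart.const`); in
  particular the Tate variation `ℤ_S(j)` and the unit `ℤ_S` (`PunctureChart.tate ∕ unit`, `InteriorChart.tate ∕ unit`).

Not here: tensor powers `D^{⊗m}` (an iterated binary tensor; reference spaces would have to be built in `ModuleCat`), duals, transfer of charts
along isomorphisms of VHS data.

## References

* [DeligneHodgeII1971] P. Deligne, *Théorie de Hodge II*, Publ. Math. IHÉS 40 (1971), 2.1.13–2.1.15.
* [CattaniElZeinGriffithsLe2014] E. Cattani et al. (eds.), *Hodge Theory*, Math. Notes 49 (2014), Ex. 3.2.23 (4), (7.6.2), Def. 7.5.9.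
* [CattaniDeligneKaplan1995] E. Cattani, P. Deligne, A. Kaplan, *On the locus of Hodge classes*, J. AMS 8 (1995), §1 (pp. 483–484), (2.4), 2.7
  (pp. 488–489).
* [CarlsonMullerStachPeters2017] J. Carlson, S. Müller-Stach, C. Peters, *Period Mappings and Period Domains*, 2nd ed. (2017), §2.3 eq. (2.6),
  Thm. 2.3.3, §15.3.
* [Schmid1973] W. Schmid, *Variation of Hodge structure*, Invent. Math. 22 (1973), §2 (cite only).
-/

noncomputable section

open scoped TensorProduct ComplexOrder
open _root_.Topology _root_.Filter Set

namespace Literature.AlgebraicGeometry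

open Module
open Motives Motives.MixedHodgeStructure Motives.HodgeStructure
open Motives.HodgeStructure (conj ofRat ofRat_apply conj_ofRat tensorBaseChange tensorEnd tensorBaseChange_tmul)
open HodgeTheory

universe u

/-! ## §1 Tate twists: `gl(H(j))^{a,b} = gl(H)^{a,b}`, `C_{H(j)} = C_H`, `‖·‖_{Q(j)} = ‖·‖_Q` -/

namespace Motives

variable {V : Type u} [AddCommGroup V] [Module ℚ V]

/-- **`gl(H(j))^{a,b} = gl(H)^{a,b}`**: the endomorphism bigrading is unchanged under Tate twist (`I^{p,q}(H(j)) = I^{p+j,q+j}(H)`, and `gl^{a,b}`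
consists of the maps of bidegree `(a, b)`). [cite: CattaniElZeinGriffithsLe2014, (7.6.2) and Ex. 3.2.23 (4)] -/
theorem MixedHodgeStructure.endPiece_tateTwist [FiniteDimensional ℚ V] (H : MixedHodgeStructure V) (j a b : ℤ) :
    (H.tateTwist j).endPiece a b = H.endPiece a b := by
  ext X
  simp only [MixedHodgeStructure.mem_endPiece_iff, MixedHodgeStructure.deligneI_tateTwist]
  constructor
  · intro h p q
    have h' := h (p - j) (q - j)
    rwa [sub_add_cancel, sub_add_cancel, show p - j + a + j = p + a by ring, show q - j + b + j = q + b by ring] at h'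
  · intro h p q
    have h' := h (p + j) (q + j)
    rwa [show p + j + a = p + a + j by ring, show q + j + b = q + b + j by ring] at h'

/-- **`‖·‖_{Q(j)} = ‖·‖_Q`**: the Hodge norm of the twisted polarization `Q(j)` of `H(j)` (same form) is the Hodge norm of `Q`.
[cite: CarlsonMullerStachPeters2017, §2.3 Thm. 2.3.3 and eq. (2.6)] [cite: DeligneHodgeII1971, 2.1.14–2.1.15] -/
theorem HodgeStructure.Polarization.hodgeNorm_tateTwist {n : ℤ} {H : HodgeStructure V n} (P : H.Polarization) (j : ℤ) (x : ℂ ⊗[ℚ] V) :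
    (P.tateTwist j).hodgeNorm x = P.hodgeNorm x := by
  -- `C_{H(j)} = C_H` is the tree's `HodgeTheory.weilOperator_tateTwist` (Weil–Jacobian file).
  unfold HodgeStructure.Polarization.hodgeNorm
  rw [HodgeTheory.weilOperator_tateTwist]
  rfl

end Motives

namespace HodgeTheory.PolarizedLimitMixedHodgeStructure

variable {V : Type u} [AddCommGroup V] [Module ℚ V] [FiniteDimensional ℚ V] {k : ℤ} (L : PolarizedLimitMixedHodgeStructure V k)

/-- `𝔤𝔩(L(j))^{a,b} = 𝔤𝔩(L)^{a,b}`. [cite: CattaniElZeinGriffithsLe2014, (7.6.2) and Ex. 3.2.23 (4)] -/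
theorem tateTwist_endPiece (j a b : ℤ) : (L.tateTwist j).toMixedHodgeStructure.endPiece a b = L.toMixedHodgeStructure.endPiece a b :=
  MixedHodgeStructure.endPiece_tateTwist L.toMixedHodgeStructure j a b

/-- `𝔟(L(j)) = 𝔟(L)` for the nilpotent subalgebra `𝔟 = ⊕_{a ≤ -1} 𝔤𝔩^{a,b}`. [cite: CattaniDeligneKaplan1995, 2.7 (p. 489)] -/
theorem tateTwist_endPiece_biSup (j : ℤ) :
    ⨆ ab ∈ {ab : ℤ × ℤ | ab.1 ≤ -1}, (L.tateTwist j).toMixedHodgeStructure.endPiece ab.1 ab.2 =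
      ⨆ ab ∈ {ab : ℤ × ℤ | ab.1 ≤ -1}, L.toMixedHodgeStructure.endPiece ab.1 ab.2 := by
  simp only [tateTwist_endPiece]

/-- The monodromy of `L(j)` is that of `L` (same `N`). [cite: CattaniElZeinGriffithsLe2014, Def. 7.5.9] -/
theorem tateTwist_monodromy (j : ℤ) : (L.tateTwist j).monodromy = L.monodromy := rfl

/-- The monodromy of the polarized limit MHS of a polarized PURE Hodge structure is `T = exp 0 = 1`. [cite: CattaniElZeinGriffithsLe2014, Def. 7.5.9] -/
theorem _root_.Literature.AlgebraicGeometry.Motives.HodgeStructure.Polarization.toPolarizedLimitMixedHodgeStructure_monodromy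
    {H : HodgeStructure V k} (P : H.Polarization) : P.toPolarizedLimitMixedHodgeStructure.monodromy = 1 := by
  show IsNilpotent.exp (0 : Module.End ℚ V) = 1
  exact IsNilpotent.exp_zero

end HodgeTheory.PolarizedLimitMixedHodgeStructure

/-! ## §2 Charts transported along an equality of weights and along a Tate twist -/

namespace Motives.VHSData

variable {S : Type} [TopologicalSpace S] {k k' : ℤ} {D : VHSData S k}
variable {V : Type u} [AddCommGroup V] [Module ℚ V] [FiniteDimensional ℚ V]

namespace PunctureChart

variable {σ : ℂ → S} {L : PolarizedLimitMixedHodgeStructure V k} (C : D.PunctureChart σ L)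

/-- **`cast`**: a puncture chart of `D` with limit `L` is a puncture chart of `D.cast h` with limit `L.cast h` (`h : k = k'`; same data).
[cite: CattaniDeligneKaplan1995, (2.4), 2.7 (pp. 488–489)] -/
def cast (h : k = k') : (D.cast h).PunctureChart σ (L.cast h) := by
  subst h
  exact { Γ := C.Γ, Γ_zero := C.Γ_zero, analyticAt_Γ := C.analyticAt_Γ, Γ_mem := C.Γ_mem, Λ := C.Λ, fg_Λ := C.fg_Λ,
          monodromy_mem := C.monodromy_mem, e := C.e, A₀ := C.A₀, map_F_eq := C.map_F_eq, form_eq := C.form_eq,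
          e_toRat_mem := C.e_toRat_mem, exists_e_toRat_eq := C.exists_e_toRat_eq }

/-- `cast` keeps the gauge. [cite: CattaniDeligneKaplan1995, 2.7 (p. 489)] -/
theorem cast_Γ (h : k = k') : (C.cast h).Γ = C.Γ := by subst h; rfl

/-- `cast` keeps the lattice. [cite: Schmid1973, §2] -/
theorem cast_Λ (h : k = k') : (C.cast h).Λ = C.Λ := by subst h; rfl

/-- `cast` keeps the height. [cite: CattaniDeligneKaplan1995, (2.4) (p. 488)] -/
theorem cast_A₀ (h : k = k') : (C.cast h).A₀ = C.A₀ := by subst h; rfl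

/-- **The Tate twist of a puncture chart**: a chart of `D` with limit `L` is a chart of `D(j)` with limit `L(j)` — same gauge, lattice, trivialization
and height (`F^q(D(j)) = F^{q+j}(D)`, `F^q(L(j)) = F^{q+j}(L)`, same `N`, `Q`, and `𝔤𝔩(L(j))^{a,b} = 𝔤𝔩(L)^{a,b}`).
[cite: DeligneHodgeII1971, 2.1.14] [cite: CattaniElZeinGriffithsLe2014, Ex. 3.2.23 (4) and Def. 7.5.9] [cite: CattaniDeligneKaplan1995, 2.7 (p. 489)] -/
def tateTwist (j : ℤ) : (D.tateTwist j).PunctureChart σ (L.tateTwist j) where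
  Γ := C.Γ
  Γ_zero := C.Γ_zero
  analyticAt_Γ := C.analyticAt_Γ
  Γ_mem s := by rw [L.tateTwist_endPiece_biSup j]; exact C.Γ_mem s
  Λ := C.Λ
  fg_Λ := C.fg_Λ
  monodromy_mem := C.monodromy_mem
  e := C.e
  A₀ := C.A₀
  map_F_eq z hz q := C.map_F_eq z hz (q + j)
  form_eq := C.form_eq
  e_toRat_mem := C.e_toRat_mem
  exists_e_toRat_eq := C.exists_e_toRat_eq

end PunctureChart

namespace InteriorChart

variable {ψ : OpenPartialHomeomorph S ℂ} {H₀ : HodgeStructure V k} {P₀ : H₀.Polarization} (C : D.InteriorChart ψ P₀)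

/-- **`cast`** of an interior chart along `h : k = k'`. [cite: CattaniDeligneKaplan1995, §1 (pp. 483–484)] -/
def cast (h : k = k') : (D.cast h).InteriorChart ψ (P₀.cast h) := by
  subst h
  exact { isPreconnected_target := C.isPreconnected_target, e := C.e, h := C.h, analyticOnNhd_h := C.analyticOnNhd_h, isUnit_h := C.isUnit_h,
          map_F_eq := C.map_F_eq, form_eq := C.form_eq, Λ := C.Λ, fg_Λ := C.fg_Λ, e_toRat_mem := C.e_toRat_mem,
          exists_e_toRat_eq := C.exists_e_toRat_eq, κ := C.κ, κ_pos := C.κ_pos, mul_hodgeNorm_le := C.mul_hodgeNorm_le }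

omit [FiniteDimensional ℚ V] in
/-- `cast` keeps the lattice. [cite: Schmid1973, §2] -/
theorem cast_Λ (h : k = k') : (C.cast h).Λ = C.Λ := by subst h; rfl

omit [FiniteDimensional ℚ V] in
/-- `cast` keeps the comparison constant. [cite: CattaniDeligneKaplan1995, §1 (p. 484)] -/
theorem cast_κ (h : k = k') : (C.cast h).κ = C.κ := by subst h; rfl

/-- **The Tate twist of an interior chart**: reference structure `(H₀(j), Q₀(j))`, same trivialization, frame, lattice and constant (the Hodge norm of
`Q(j)` is that of `Q`). [cite: DeligneHodgeII1971, 2.1.14] [cite: CattaniDeligneKaplan1995, §1 (pp. 483–484)] -/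
def tateTwist (j : ℤ) : (D.tateTwist j).InteriorChart ψ (P₀.tateTwist j) where
  isPreconnected_target := C.isPreconnected_target
  e := C.e
  h := C.h
  analyticOnNhd_h := C.analyticOnNhd_h
  isUnit_h := C.isUnit_h
  map_F_eq c hc q := C.map_F_eq c hc (q + j)
  form_eq := C.form_eq
  Λ := C.Λ
  fg_Λ := C.fg_Λ
  e_toRat_mem := C.e_toRat_mem
  exists_e_toRat_eq := C.exists_e_toRat_eq
  κ := C.κ
  κ_pos := C.κ_pos
  mul_hodgeNorm_le c hc x := by
    show C.κ * (P₀.tateTwist j).hodgeNorm _ ≤ ((D.form (ψ.symm c)).tateTwist j).hodgeNorm x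
    rw [HodgeStructure.Polarization.hodgeNorm_tateTwist, HodgeStructure.Polarization.hodgeNorm_tateTwist]
    exact C.mul_hodgeNorm_le c hc x

end InteriorChart

end Motives.VHSData

/-! ## §3 The charts of a constant variation (trivial local monodromy): `ℤ_S(j)`, `ℤ_S` -/

namespace Motives.VHSData

variable (S : Type) [TopologicalSpace S]
variable {M : Type} [AddCommGroup M] [Module.Finite ℤ M] [Module.Free ℤ M] {V : Type} [AddCommGroup V] [Module ℚ V] [FiniteDimensional ℚ V]
  {ι : M →ₗ[ℤ] V} (hι : IsBaseChange ℚ ι) {n : ℤ} {H : HodgeStructure V n} (Q : H.Polarization)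

/-- **The puncture chart of the CONSTANT variation attached to a polarized `ℤ`-Hodge structure `(M ⊆ V, H, Q)`, along any `σ`**: limit
`(H, Q)` with `N = 0` (trivial local monodromy), gauge `Γ = 0`, lattice `ι(M)`, identity trivialization, height `0` — the period map is constant
(`Φ(z) = F`). [cite: CattaniDeligneKaplan1995, (2.4), 2.7 (pp. 488–489)] [cite: CattaniElZeinGriffithsLe2014, Def. 7.5.9 (`N = 0`)] -/
def PunctureChart.const (σ : ℂ → S) : (VHSData.const S hι Q).PunctureChart σ Q.toPolarizedLimitMixedHodgeStructure where
  Γ _ := 0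
  Γ_zero := rfl
  analyticAt_Γ φ w := by simp only [LinearMap.zero_apply, map_zero]; exact analyticAt_const
  Γ_mem _ := Submodule.zero_mem _
  Λ := LinearMap.range ι
  fg_Λ := by rw [LinearMap.range_eq_map]; exact (Module.Finite.fg_top (R := ℤ) (M := M)).map ι
  monodromy_mem u hu := by rw [Q.toPolarizedLimitMixedHodgeStructure_monodromy, Module.End.one_apply]; exact hu
  e _ := LinearEquiv.refl ℚ V
  A₀ := 0
  map_F_eq z _ q := by
    show ((H.F q).map ((LinearEquiv.refl ℚ V).toLinearMap.baseChange ℂ)) =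
      ((H.F q).map (IsNilpotent.exp (0 : Module.End ℂ (ℂ ⊗[ℚ] V)))).map (IsNilpotent.exp (z • (0 : V →ₗ[ℚ] V).baseChange ℂ))
    rw [LinearEquiv.refl_toLinearMap, LinearMap.baseChange_id, Submodule.map_id, LinearMap.baseChange_zero, smul_zero,
      IsNilpotent.exp_zero, Module.End.one_eq_id, Submodule.map_id, Submodule.map_id]
  form_eq _ _ _ _ := rfl
  e_toRat_mem z _ u := by
    show (VHSData.const S hι Q).toRat (σ z) u ∈ LinearMap.range ι
    rw [const_toRat]; exact LinearMap.mem_range_self ι u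
  exists_e_toRat_eq z _ v hv := by
    obtain ⟨m, rfl⟩ := hv
    exact ⟨m, by rw [← const_toRat (S := S) hι Q (σ z) m]; rfl⟩

/-- **The interior chart of the constant variation on any coordinate disc**: reference `(H, Q)`, identity trivialization, frame `h = 1`, lattice
`ι(M)`, constant `κ = 1`. [cite: CattaniDeligneKaplan1995, §1 (pp. 483–484)] -/
def InteriorChart.const (ψ : OpenPartialHomeomorph S ℂ) (hψ : IsPreconnected ψ.target) :
    (VHSData.const S hι Q).InteriorChart ψ Q where
  isPreconnected_target := hψ
  e _ := LinearEquiv.refl ℚ V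
  h _ := 1
  analyticOnNhd_h φ w c _ := analyticAt_const
  isUnit_h _ _ := isUnit_one
  map_F_eq c _ q := by
    show (H.F q).map ((LinearEquiv.refl ℚ V).toLinearMap.baseChange ℂ) = (H.F q).comap (1 : Module.End ℂ (ℂ ⊗[ℚ] V))
    rw [LinearEquiv.refl_toLinearMap, LinearMap.baseChange_id, Submodule.map_id, Module.End.one_eq_id, Submodule.comap_id]
  form_eq _ _ _ _ := rfl
  Λ := LinearMap.range ι
  fg_Λ := by rw [LinearMap.range_eq_map]; exact (Module.Finite.fg_top (R := ℤ) (M := M)).map ι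
  e_toRat_mem c _ u := by
    show (VHSData.const S hι Q).toRat (ψ.symm c) u ∈ LinearMap.range ι
    rw [const_toRat]; exact LinearMap.mem_range_self ι u
  exists_e_toRat_eq c _ v hv := by
    obtain ⟨m, rfl⟩ := hv
    exact ⟨m, by rw [← const_toRat (S := S) hι Q (ψ.symm c) m]; rfl⟩
  κ := 1
  κ_pos := one_pos
  mul_hodgeNorm_le c _ x := by
    show 1 * Q.hodgeNorm ((LinearEquiv.refl ℚ V).toLinearMap.baseChange ℂ x) ≤ Q.hodgeNorm x
    rw [LinearEquiv.refl_toLinearMap, LinearMap.baseChange_id, LinearMap.id_apply, one_mul]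

/-- The puncture chart of the Tate variation `ℤ_S(j)` (limit `ℚ(j)` with `N = 0`, `Γ = 0`, `Λ = ℤ`). [cite: CattaniDeligneKaplan1995, (2.4), 2.7 (pp. 488–489)] -/
def PunctureChart.tate (j : ℤ) (σ : ℂ → S) :
    (VHSData.tate S j).PunctureChart σ (HodgeStructure.Polarization.tate j).toPolarizedLimitMixedHodgeStructure :=
  PunctureChart.const S (IsBaseChange.linearMap ℤ ℚ) (HodgeStructure.Polarization.tate j) σ

/-- The puncture chart of the unit variation `ℤ_S`. [cite: CattaniDeligneKaplan1995, (2.4), 2.7 (pp. 488–489)] -/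
def PunctureChart.unit (σ : ℂ → S) :
    (VHSData.unit S).PunctureChart σ ((HodgeStructure.Polarization.tate 0).toPolarizedLimitMixedHodgeStructure.cast (mul_zero (-2))) :=
  (PunctureChart.tate S 0 σ).cast (mul_zero (-2))

/-- The interior chart of `ℤ_S(j)` on a coordinate disc. [cite: CattaniDeligneKaplan1995, §1 (pp. 483–484)] -/
def InteriorChart.tate (j : ℤ) (ψ : OpenPartialHomeomorph S ℂ) (hψ : IsPreconnected ψ.target) :
    (VHSData.tate S j).InteriorChart ψ (HodgeStructure.Polarization.tate j) :=
  InteriorChart.const S (IsBaseChange.linearMap ℤ ℚ) (HodgeStructure.Polarization.tate j) ψ hψ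

/-- The interior chart of `ℤ_S` on a coordinate disc. [cite: CattaniDeligneKaplan1995, §1 (pp. 483–484)] -/
def InteriorChart.unit (ψ : OpenPartialHomeomorph S ℂ) (hψ : IsPreconnected ψ.target) :
    (VHSData.unit S).InteriorChart ψ ((HodgeStructure.Polarization.tate 0).cast (mul_zero (-2))) :=
  (InteriorChart.tate S 0 ψ hψ).cast (mul_zero (-2))

end Motives.VHSData

end Literature.AlgebraicGeometry

end
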